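import Summits.RiemannHypothesis.RiemannHypothesis.Theorems.HandoffEdgeAsymptotic
import Mathlib.NumberTheory.PrimeCounting
import HarnessLib
import Literature.NumberTheory.LFunctions.HeathBrownLargeGapSum

/-!
# HANDOFF, edge block: UNCONDITIONALLY for ALMOST ALL primes — the exceptional set in `(x/2, x]` has `≪ x^{1/10+ε}` elements, given Heath-Brown's large-gap sum (rh-explicit, track «HANDOFF», seat prove-2 gen3, ATTEMPT-10)

HONEST FRAMING. Nothing here bears on RH. ATTEMPT-8/9 calibrated the edge block of the Schur split EXACTLY on the
prime-gap scale: for all large `q` it is the statement `q⁺ − q ≤ (1 ± o(1))·√q·log q`, open for ALL `q`. The literature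
seat (LIT-ASPRINTED §28) observed that print controls the EXCEPTIONS: Heath-Brown 2021 (Differences V), Theorem 1,
`Σ_{p_n ≤ x, p_{n+1} − p_n ≥ √p_n} (p_{n+1} − p_n) ≪_ε x^{3/5+ε}`. Since a failure of the hypothesis of
`edgeNonneg_of_gap_le` (`q⁺ − q ≤ ½√q log q`) forces `q⁺ − q ≥ √q` once `log q ≥ 2`, this gives:

* `HeathBrown2021_sqrtGapSum` — NAMED FACT (a theorem in print, stated with Mathlib's `Nat.nth Nat.Prime`; taken as a
  hypothesis, NOT proved here).
* `consecutivePrimes_nth` — `p_n < p_{n+1}` are consecutive primes in the sense of `HandoffWindow.lean` (PROVED).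
* `edgeExceptional x` — the indices `n` with `x/2 < p_n ≤ x` and `p_{n+1} − p_n > ½·√p_n·log p_n` (DEFINITION).
* `edgeNonneg_nth_of_not_mem_edgeExceptional` — for `x/2 < p_n ≤ x`, `p_n ≥ e⁸⁰`, `n ∉ edgeExceptional x`:
  `EdgeNonneg p_n p_{n+1} η` for every `0 < η ≤ 1/(4p_n)` (PROVED, from `edgeNonneg_of_gap_le`).
* `card_edgeExceptional_le` — GIVEN the named fact: `∀ ε > 0 ∃ C ∀ x ≥ 16, #(edgeExceptional x) ≤ C·x^{1/10+ε}` (PROVED: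
  each exceptional gap is `≥ √p_n ≥ √(x/2)`, and the exceptional indices lie in Heath-Brown's set).
* `edgeNonneg_almost_all` — the two together (PROVED, CONDITIONAL on the named fact).

DOES NOT GIVE: anything at an exceptional `q` (there only Baker–Harman–Pintz-type bounds are known), hence no
telescoping along ALL primes; nothing about the coupling law / `H(q)`. The dyadic block `(x/2, x]` is kept explicit
(summing over blocks gives `≪ x^{1/10+ε}` exceptions up to `x`; not done here).
-/

set_option linter.dupNamespace false

noncomputable section

open Complex Filter Set MeasureTheory Literature.NumberTheory.LFunctions
open scoped Real Topology ComplexConjugate ContDiff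

namespace Summit.RiemannHypothesis.RiemannHypothesis.Theorems.Handoff

/-! ## §1 The named fact (Heath-Brown 2021, Theorem 1) -/

/-- `p_n < p_{n+1}` are consecutive primes (`HandoffWindow.ConsecutivePrimes`). [folklore] -/
theorem consecutivePrimes_nth (n : ℕ) : ConsecutivePrimes (Nat.nth Nat.Prime n) (Nat.nth Nat.Prime (n + 1)) := by
  have hinf := Nat.infinite_setOf_prime
  refine ⟨Nat.prime_nth_prime n, Nat.prime_nth_prime (n + 1), (Nat.nth_lt_nth hinf).2 (Nat.lt_succ_self n),
    fun p hp hlt ↦ ?_⟩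
  have hp' : Nat.nth Nat.Prime (Nat.count Nat.Prime p) = p := Nat.nth_count hp
  rw [← hp'] at hlt ⊢
  exact (Nat.nth_le_nth hinf).2 (Nat.succ_le_of_lt ((Nat.nth_lt_nth hinf).1 hlt))

/-- Consecutive primes are consecutive `nth` primes: `ConsecutivePrimes q q′ → q = p_n ∧ q′ = p_{n+1}` with `n = #{primes < q}`. [folklore] -/
theorem ConsecutivePrimes.eq_nth {q q' : ℕ} (h : ConsecutivePrimes q q') :
    q = Nat.nth Nat.Prime (Nat.count Nat.Prime q) ∧ q' = Nat.nth Nat.Prime (Nat.count Nat.Prime q + 1) := by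
  have hq : Nat.nth Nat.Prime (Nat.count Nat.Prime q) = q := Nat.nth_count h.1
  refine ⟨hq.symm, ?_⟩
  have hc := consecutivePrimes_nth (Nat.count Nat.Prime q)
  rw [hq] at hc
  exact le_antisymm (h.2.2.2 _ hc.2.1 hc.2.2.1) (hc.2.2.2 _ h.2.1 h.2.2.1)

/-- **The edge block at an index with a non-exceptional gap.** For `p_n ≥ e⁸⁰` with `p_{n+1} − p_n ≤ ½·√p_n·log p_n` and an
overlap `0 < η ≤ 1/(4p_n)`: `EdgeNonneg p_n p_{n+1} η` (`edgeNonneg_of_gap_le` at consecutive `nth` primes). [this track, ATTEMPT-8, ATTEMPT-10] -/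
theorem edgeNonneg_nth_of_gap_le {n : ℕ} (hq : Real.exp 80 ≤ (Nat.nth Nat.Prime n : ℝ))
    (hgap : (Nat.nth Nat.Prime (n + 1) : ℝ) - Nat.nth Nat.Prime n ≤
      Real.sqrt (Nat.nth Nat.Prime n) * Real.log (Nat.nth Nat.Prime n) / 2)
    {η : ℝ} (hη : 0 < η) (hηq : η ≤ 1 / (4 * (Nat.nth Nat.Prime n : ℝ))) :
    EdgeNonneg (Nat.nth Nat.Prime n) (Nat.nth Nat.Prime (n + 1)) η :=
  edgeNonneg_of_gap_le (consecutivePrimes_nth n) hq hgap hη hηq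

/-! ## §3 The exceptional set in a dyadic block and its size -/

/-- The exceptional indices of the block `(x/2, x]`: `n ≤ ⌊x⌋` with `x/2 < p_n ≤ x` and `p_{n+1} − p_n > ½·√p_n·log p_n`
(the primes of the block at which `edgeNonneg_of_gap_le` does not apply). [this track, ATTEMPT-10] -/
def edgeExceptional (x : ℝ) : Finset ℕ :=
  (Finset.range (⌊x⌋₊ + 1)).filter (fun n ↦ x / 2 < (Nat.nth Nat.Prime n : ℝ) ∧ (Nat.nth Nat.Prime n : ℝ) ≤ x ∧
    Real.sqrt (Nat.nth Nat.Prime n) * Real.log (Nat.nth Nat.Prime n) / 2 <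
      (Nat.nth Nat.Prime (n + 1) : ℝ) - Nat.nth Nat.Prime n)

/-- `p_n ≤ x` puts the index in range: `n ≤ ⌊x⌋` (`p_n ≥ n + 2`). [folklore] -/
theorem mem_range_of_nth_le {n : ℕ} {x : ℝ} (hx : (Nat.nth Nat.Prime n : ℝ) ≤ x) : n ∈ Finset.range (⌊x⌋₊ + 1) := by
  rw [Finset.mem_range, Nat.lt_succ_iff]
  have h1 : (n : ℝ) ≤ Nat.nth Nat.Prime n := by exact_mod_cast (Nat.add_two_le_nth_prime n).trans' (Nat.le_add_right n 2)
  exact Nat.le_floor (h1.trans hx)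

/-- **The edge block off the exceptional set.** For `x/2 < p_n ≤ x` with `p_n ≥ e⁸⁰` and `n ∉ edgeExceptional x`:
`EdgeNonneg p_n p_{n+1} η` for every `0 < η ≤ 1/(4p_n)`. [this track, ATTEMPT-10] -/
theorem edgeNonneg_nth_of_not_mem_edgeExceptional {n : ℕ} {x : ℝ} (hlo : x / 2 < (Nat.nth Nat.Prime n : ℝ))
    (hhi : (Nat.nth Nat.Prime n : ℝ) ≤ x) (hq : Real.exp 80 ≤ (Nat.nth Nat.Prime n : ℝ)) (hn : n ∉ edgeExceptional x)
    {η : ℝ} (hη : 0 < η) (hηq : η ≤ 1 / (4 * (Nat.nth Nat.Prime n : ℝ))) :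
    EdgeNonneg (Nat.nth Nat.Prime n) (Nat.nth Nat.Prime (n + 1)) η := by
  refine edgeNonneg_nth_of_gap_le hq ?_ hη hηq
  by_contra hgap
  rw [not_le] at hgap
  exact hn (Finset.mem_filter.2 ⟨mem_range_of_nth_le hhi, hlo, hhi, hgap⟩)

/-- An exceptional index of the block `(x/2, x]`, `x ≥ 16`, has `p_{n+1} − p_n ≥ √p_n ≥ √(x/2)` (`½ log p_n ≥ 1` since
`p_n > 8 > e²`). [folklore] -/
theorem sqrt_le_gap_of_mem_edgeExceptional {n : ℕ} {x : ℝ} (hx : 16 ≤ x) (hn : n ∈ edgeExceptional x) :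
    Real.sqrt (Nat.nth Nat.Prime n) ≤ (Nat.nth Nat.Prime (n + 1) : ℝ) - Nat.nth Nat.Prime n ∧
      Real.sqrt (x / 2) ≤ (Nat.nth Nat.Prime (n + 1) : ℝ) - Nat.nth Nat.Prime n := by
  obtain ⟨-, hlo, -, hgap⟩ := Finset.mem_filter.1 hn
  set p : ℝ := (Nat.nth Nat.Prime n : ℝ) with hp
  have hp8 : 8 < p := by linarith
  have hlog : 2 ≤ Real.log p := by
    rw [Real.le_log_iff_exp_le (by linarith)]
    have := Real.exp_one_lt_d9
    have h2 : Real.exp 2 = Real.exp 1 * Real.exp 1 := by rw [← Real.exp_add]; norm_num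
    nlinarith [Real.exp_pos 1]
  have hsq0 : 0 ≤ Real.sqrt p := Real.sqrt_nonneg _
  have h1 : Real.sqrt p ≤ Real.sqrt p * Real.log p / 2 := by nlinarith
  have h2 : Real.sqrt (x / 2) ≤ Real.sqrt p := Real.sqrt_le_sqrt hlo.le
  exact ⟨h1.trans hgap.le, h2.trans (h1.trans hgap.le)⟩

/-- **The exceptional set is power-small**, GIVEN Heath-Brown's theorem: for every `ε > 0` there is `C` with
`#(edgeExceptional x) ≤ C·x^{1/10+ε}` for all `x ≥ 16`. Proof: the exceptional indices lie in Heath-Brown's set (gap `≥ √p_n`),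
each contributes a gap `≥ √(x/2)`, so `#E·√(x/2) ≤ Σ gaps ≤ C₀x^{3/5+ε}` and `x^{3/5+ε}/√(x/2) = √2·x^{1/10+ε}`.
CONDITIONAL on the named fact `HeathBrown2021_sqrtGapSum`. [cite: HeathBrown2021DifferencesV, Thm 1; this track, ATTEMPT-10 (the counting step is LIT-ASPRINTED §28B)] -/
theorem card_edgeExceptional_le (hHB : Literature.NumberTheory.LFunctions.HeathBrown2021_sqrtGapSum) {ε : ℝ} (hε : 0 < ε) :
    ∃ C : ℝ, ∀ x : ℝ, 16 ≤ x → ((edgeExceptional x).card : ℝ) ≤ C * x ^ (1 / 10 + ε) := by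
  obtain ⟨C₀, hC₀⟩ := hHB ε hε
  refine ⟨C₀ * Real.sqrt 2, fun x hx ↦ ?_⟩
  have hx0 : 0 < x := by linarith
  set gap : ℕ → ℝ := fun n ↦ (Nat.nth Nat.Prime (n + 1) : ℝ) - Nat.nth Nat.Prime n with hgap_def
  set HB : Finset ℕ := (Finset.range (⌊x⌋₊ + 1)).filter (fun n ↦ (Nat.nth Nat.Prime n : ℝ) ≤ x ∧
      Real.sqrt (Nat.nth Nat.Prime n) ≤ (Nat.nth Nat.Prime (n + 1) : ℝ) - Nat.nth Nat.Prime n) with hHB_def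
  have hbound : ∑ n ∈ HB, gap n ≤ C₀ * x ^ (3 / 5 + ε) := hC₀ x (by linarith)
  -- E ⊆ HB
  have hsub : edgeExceptional x ⊆ HB := by
    intro n hn
    have hg := (sqrt_le_gap_of_mem_edgeExceptional hx hn).1
    obtain ⟨hr, -, hhi, -⟩ := Finset.mem_filter.1 hn
    exact Finset.mem_filter.2 ⟨hr, hhi, hg⟩
  have hgap0 : ∀ n ∈ HB, 0 ≤ gap n := by
    intro n hn
    obtain ⟨-, -, hg⟩ := Finset.mem_filter.1 hn
    exact (Real.sqrt_nonneg _).trans hg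
  -- #E · √(x/2) ≤ Σ_E gap ≤ Σ_HB gap
  have hsum_E : ((edgeExceptional x).card : ℝ) * Real.sqrt (x / 2) ≤ ∑ n ∈ edgeExceptional x, gap n := by
    rw [← nsmul_eq_mul, ← Finset.sum_const]
    exact Finset.sum_le_sum fun n hn ↦ (sqrt_le_gap_of_mem_edgeExceptional hx hn).2
  have hsum_le : ∑ n ∈ edgeExceptional x, gap n ≤ ∑ n ∈ HB, gap n :=
    Finset.sum_le_sum_of_subset_of_nonneg hsub fun n hn _ ↦ hgap0 n hn
  have hmain : ((edgeExceptional x).card : ℝ) * Real.sqrt (x / 2) ≤ C₀ * x ^ (3 / 5 + ε) := by linarith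
  -- divide by √(x/2) and rewrite the powers
  have hsqx : 0 < Real.sqrt (x / 2) := Real.sqrt_pos.2 (by linarith)
  have hpow : x ^ (3 / 5 + ε) = Real.sqrt x * x ^ (1 / 10 + ε) := by
    rw [Real.sqrt_eq_rpow, ← Real.rpow_add hx0]; congr 1; ring
  have hsq2 : Real.sqrt (x / 2) * Real.sqrt 2 = Real.sqrt x := by
    rw [← Real.sqrt_mul (by linarith)]; congr 1; ring
  rw [← le_div_iff₀ hsqx] at hmain
  calc ((edgeExceptional x).card : ℝ) ≤ C₀ * x ^ (3 / 5 + ε) / Real.sqrt (x / 2) := hmain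
    _ = C₀ * Real.sqrt 2 * x ^ (1 / 10 + ε) := by
        rw [hpow, ← hsq2]
        field_simp

/-- **The edge block holds for ALMOST ALL primes, unconditionally given Heath-Brown 2021.** For every `ε > 0` there is `C`
such that for all `x ≥ 16`: the block `(x/2, x]` contains at most `C·x^{1/10+ε}` exceptional prime indices, and at every
other index `n` with `x/2 < p_n ≤ x`, `p_n ≥ e⁸⁰`: `EdgeNonneg p_n p_{n+1} η` for all `0 < η ≤ 1/(4p_n)`. So the RH-free
conjunct of Route 1′'s increment — of Cramér strength when demanded at EVERY large prime (ATTEMPT-9) — is a theorem off a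
power-small exceptional set. It gives NOTHING at the exceptional primes and nothing about the coupling law; nothing here
bears on RH. CONDITIONAL on `HeathBrown2021_sqrtGapSum`. [cite: HeathBrown2021DifferencesV, Thm 1; this track, ATTEMPT-10] -/
theorem edgeNonneg_almost_all (hHB : Literature.NumberTheory.LFunctions.HeathBrown2021_sqrtGapSum) {ε : ℝ} (hε : 0 < ε) :
    ∃ C : ℝ, ∀ x : ℝ, 16 ≤ x →
      ((edgeExceptional x).card : ℝ) ≤ C * x ^ (1 / 10 + ε) ∧
        ∀ n : ℕ, x / 2 < (Nat.nth Nat.Prime n : ℝ) → (Nat.nth Nat.Prime n : ℝ) ≤ x →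
          Real.exp 80 ≤ (Nat.nth Nat.Prime n : ℝ) → n ∉ edgeExceptional x →
            ∀ η : ℝ, 0 < η → η ≤ 1 / (4 * (Nat.nth Nat.Prime n : ℝ)) →
              EdgeNonneg (Nat.nth Nat.Prime n) (Nat.nth Nat.Prime (n + 1)) η := by
  obtain ⟨C, hC⟩ := card_edgeExceptional_le hHB hε
  exact ⟨C, fun x hx ↦ ⟨hC x hx, fun n hlo hhi hq hn η hη hηq ↦
    edgeNonneg_nth_of_not_mem_edgeExceptional hlo hhi hq hn hη hηq⟩⟩

/-- Prime-indexed reading: for consecutive primes `q < q′` in the block `(x/2, x]` with `q ≥ e⁸⁰` whose index `#{primes < q}`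
is not exceptional, `EdgeNonneg q q′ η`. [this track, ATTEMPT-10] -/
theorem edgeNonneg_of_count_not_mem_edgeExceptional {q q' : ℕ} (h : ConsecutivePrimes q q') {x : ℝ}
    (hlo : x / 2 < (q : ℝ)) (hhi : (q : ℝ) ≤ x) (hq : Real.exp 80 ≤ (q : ℝ))
    (hn : Nat.count Nat.Prime q ∉ edgeExceptional x) {η : ℝ} (hη : 0 < η) (hηq : η ≤ 1 / (4 * (q : ℝ))) :
    EdgeNonneg q q' η := by
  obtain ⟨h1, h2⟩ := h.eq_nth
  rw [h1] at hlo hhi hq hηq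
  rw [h1, h2]
  exact edgeNonneg_nth_of_not_mem_edgeExceptional hlo hhi hq hn hη hηq

end Summit.RiemannHypothesis.RiemannHypothesis.Theorems.Handoff
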